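import Summits.NavierStokesRegularity.NavierStokesRegularity.Theses.AxisymmetricExtremality
import Summits.NavierStokesRegularity.NavierStokesRegularity.Theorems.AxisymmetricExtremalityAxisymmetricKatoGlobalStubSereginLogSwirlOriginStep3KeyUnconditional
import Summits.NavierStokesRegularity.NavierStokesRegularity.Theorems.AxisymmetricExtremalityAxisymmetricKatoGlobalStubSereginLogSwirlOriginStep4Assembly
import Literature.Analysis.FluidPDE.TaoEnstrophyLocalisation
import HarnessLib

/-!
# Seregin 2022, §2 Step 1 ⇒ Step 3: the cut-off source constant `Bcut` (`A₁ + B₁`, `A₂ + B₂`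
# of Step 3) for a time-independent cut-off, from sup-norm bounds of `v, D²v` on `supp ∇ζ` —
# crux stmt-NavierStokesRegularity-15453 (`AxisymmetricExtremality.AxisymmetricKatoGlobal`), line registered, support for stub `stub_sereginLogSwirlOrigin`

Support file (`--supports stmt-NavierStokesRegularity-15453`; theorems only, everything proved)
toward the registered stub `stub_sereginLogSwirlOrigin` = the named fact
`Literature.Analysis.FluidPDE.seregin2022_logSwirl_regularAtOrigin` (G. Seregin, J. Math. Fluid
Mech. 24 (2022), Paper 27 = arXiv:2201.00153, §2).  The landed key estimate
(`cutoff_energy_keyEstimate_unconditional`, `…Step3KeyUnconditional.lean`) takes at every time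
`t` of the slab the hypothesis `hcut`:

  `(2∫ζ ∂ₜζ Γ² + 2∫ζΓ² ∇ζ·v + 2ν∫Γ²|∇ζ|² − 4ν∫ζΓ² q_ζ) + (the same with Φ) ≤ Bcut`

(`Γ = angVortQuot (v t)`, `Φ = radVelQuot (curl (v t))`, `q_ζ = radDerivQuot ζ`, gradients in
coordinates), the integrated cut-off terms `A₁ + B₁ = ∫(Φ² + Γ²)Ψ`, `Ψ = ∂ₜη⁶ + Δη⁶`, and
`A₂ + B₂ = ∫(v − 2x'/|x'|²)·∇η⁶ (Φ² + Γ²)` of Step 3 (arXiv p. 6), which the paper bounds by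
"`C(v, η)`" using "`|Γ|² + |Φ|² ≤ |∇ω|²` and boundedness of `|∇ω|`" on `supp ∇η` and
"`(x'/|x'|²)·∇η = (1/|x'|)η,ᵣ ≤ C(η)`".  On the final slab the Step-1 cut-off is time
independent (`ξ = 1`), so `∂ₜζ = 0`; this file proves `hcut` for `ζ(t, ·) = ζ` from
`‖v‖ ≤ D₀`, `‖D²v‖ ≤ D₂` on a set `K ⊇ tsupport ∇ζ`, `‖∇ζ‖ ≤ Z₁`, `|q_ζ| ≤ Q₀`, `0 ≤ ζ ≤ 1`,
`tsupport ζ ⊆ 𝒞 ⊆ B̄(0, 2)`, `|B̄(0,2)| ≤ V`, with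

  `Bcut = 2 (2Z₁D₀ + 2νZ₁² + 4νQ₀)(κD₂)² V`     (`κ = ‖curlCLM‖`, `|Γ|, |Φ| ≤ κ‖D²v‖`):

* `abs_integral_le_of_forall_abs_le` — `|∫f| ≤ P·vol` for `|f| ≤ P` vanishing off `B̄(0, 2)`;
* `timeDerivWithin_const_eq_zero` — `∂ₜ` of a time-independent cut-off vanishes;
* `cut_group_le` — one group (`Γ` or `Φ` replaced by any `G` with `|G| ≤ B` on `K`);
* `cut_bound` (registered sub-goal) — **`hcut` for the time-independent cut-off**.

## Mathlib / tree search

Tree: `norm_fderiv_sq_eq_sum_sq` (`…Step4Assembly`), `radDerivQuot_eq_zero_of_notMem_tsupport_fderiv`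
(`…Step3KeyUnconditional`), `spaceCyl_subset_closedBall` (`…LerayLogHardy`), `norm_fderiv_curl_le`
(`TaoEnstrophyLocalisation`), `IsAxisymmetric.abs_angVortQuot_le_norm_fderiv_curl`,
`…abs_radVelQuot_curl_le_norm_fderiv_curl` (`AxisymQuotientBounds`). Mathlib:
`norm_setIntegral_le_of_norm_le_const`, `setIntegral_eq_integral_of_forall_compl_eq_zero`,
`derivWithin_fun_const`, `image_eq_zero_of_notMem_tsupport`, `tsupport_fderiv_subset`.

## References

* G. Seregin, J. Math. Fluid Mech. 24 (2022), Paper No. 27 = arXiv:2201.00153, §2 Step 3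
  (arXiv p. 6: `A₁ + B₁ ≤ C(v, η)`, `A₂ + B₂ ≤ C(v, η)`), Step 1 (p. 5, `ξ = 1` for `t ≥ -1/64`).
  [`Seregin2022LocalAxisym`]
-/

noncomputable section

open Set Filter Topology Function Metric MeasureTheory
open scoped ContDiff
open Literature.Analysis.FluidPDE

-- `<Problem> = <Summit>` duplicates a namespace component by design (lakefile sets the same option).
set_option linter.dupNamespace false

namespace Summit.NavierStokesRegularity.NavierStokesRegularity.Theorems.AxisymmetricKatoGlobal.EulerScaling

/-! ### Tools -/

section Tools

/-- **`|∫ f| ≤ P · |B̄(0,2)|`** for a real function with `|f| ≤ P` everywhere which vanishes off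
the closed ball `B̄(0, 2)` (no integrability needed). [folklore] -/
theorem abs_integral_le_of_forall_abs_le {f : EuclideanSpace ℝ (Fin 3) → ℝ} {P : ℝ}
    (hP : ∀ x, |f x| ≤ P) (h0 : ∀ x ∉ closedBall (0 : EuclideanSpace ℝ (Fin 3)) 2, f x = 0) :
    |∫ x, f x| ≤ P * volume.real (closedBall (0 : EuclideanSpace ℝ (Fin 3)) 2) := by
  have h3 : ∫ x in closedBall (0 : EuclideanSpace ℝ (Fin 3)) 2, f x = ∫ x, f x :=
    setIntegral_eq_integral_of_forall_compl_eq_zero fun x hx => h0 x hx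
  have h4 := norm_setIntegral_le_of_norm_le_const (μ := volume)
    (s := closedBall (0 : EuclideanSpace ℝ (Fin 3)) 2) (f := f) measure_closedBall_lt_top
    fun x _ => (show ‖f x‖ ≤ P by rw [Real.norm_eq_abs]; exact hP x)
  rwa [h3, Real.norm_eq_abs] at h4

/-- **`∂ₜζ = 0` for a time-independent cut-off**: `timeDerivWithin S (fun _ => ζ) t x = 0`. [folklore] -/
theorem timeDerivWithin_const_eq_zero (S : Set ℝ) (ζ : EuclideanSpace ℝ (Fin 3) → ℝ) (t : ℝ)
    (x : EuclideanSpace ℝ (Fin 3)) : timeDerivWithin S (fun _ : ℝ => ζ) t x = 0 := by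
  rw [timeDerivWithin_apply, derivWithin_fun_const]
  rfl

end Tools

/-! ### One group of `hcut` -/

section Group

variable {u : EuclideanSpace ℝ (Fin 3) → EuclideanSpace ℝ (Fin 3)} {ζ G : EuclideanSpace ℝ (Fin 3) → ℝ}
  {K : Set (EuclideanSpace ℝ (Fin 3))} {a b ν t D₀ Z₁ Q₀ V B : ℝ}

/-- **One group of the cut-off source** (`Γ` or `Φ` replaced by any `G` with `|G| ≤ B` on
`K ⊇ tsupport ∇ζ`, any real `B`): for a time-independent axisymmetric `ζ ∈ C²` with `0 ≤ ζ ≤ 1`,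
`tsupport ζ ⊆ 𝒞`, `‖∇ζ‖ ≤ Z₁`, `|q_ζ| ≤ Q₀`, and `‖v‖ ≤ D₀` on `K`,
`2∫ζ∂ₜζG² + 2∫ζG²∇ζ·v + 2ν∫G²|∇ζ|² − 4ν∫ζG²q_ζ ≤ (2Z₁D₀ + 2νZ₁² + 4νQ₀)B²V` (the first
integrand is zero; the others vanish off `tsupport ∇ζ ⊆ B̄(0,2)` and are bounded there by
`B²Z₁D₀`, `B²Z₁²`, `B²Q₀`). [cite: Seregin2022LocalAxisym, §2 Step 3 (arXiv:2201.00153 p. 6), A₁+B₁ and A₂+B₂ ≤ C(v,η)] -/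
theorem cut_group_le (hζ : ContDiff ℝ 2 ζ) (hζax : IsAxisymmetricScalar ζ)
    (hζ01 : ∀ x, 0 ≤ ζ x ∧ ζ x ≤ 1) (hζ1 : tsupport ζ ⊆ SereginSverak2009.spaceCyl 0 1)
    (hK : tsupport (fderiv ℝ ζ) ⊆ K) (hν : 0 ≤ ν) (hD₀ : 0 ≤ D₀) (hZ₁0 : 0 ≤ Z₁)
    (hQ₀0 : 0 ≤ Q₀) (hV : volume.real (closedBall (0 : EuclideanSpace ℝ (Fin 3)) 2) ≤ V)
    (hZ₁ : ∀ x, ‖fderiv ℝ ζ x‖ ≤ Z₁) (hQ₀ : ∀ x, |radDerivQuot ζ x| ≤ Q₀)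
    (h0 : ∀ x ∈ K, ‖u x‖ ≤ D₀) (hGB : ∀ x ∈ K, |G x| ≤ B) :
    2 * (∫ x, ζ x * timeDerivWithin (Ioo a b) (fun _ : ℝ => ζ) t x * G x ^ 2) +
      2 * (∫ x, ζ x * G x ^ 2 * fderiv ℝ ζ x (u x)) +
      2 * ν * (∫ x, G x ^ 2 * (fderiv ℝ ζ x (EuclideanSpace.single 0 1) ^ 2 +
        fderiv ℝ ζ x (EuclideanSpace.single 1 1) ^ 2 + fderiv ℝ ζ x (EuclideanSpace.single 2 1) ^ 2)) -
      4 * ν * (∫ x, ζ x * G x ^ 2 * radDerivQuot ζ x) ≤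
      (2 * (Z₁ * D₀) + 2 * ν * Z₁ ^ 2 + 4 * ν * Q₀) * B ^ 2 * V := by
  have hVOL : 0 ≤ volume.real (closedBall (0 : EuclideanSpace ℝ (Fin 3)) 2) := measureReal_nonneg
  set W : ℝ := volume.real (closedBall (0 : EuclideanSpace ℝ (Fin 3)) 2) with hW
  -- geometry: `tsupport ∇ζ ⊆ tsupport ζ ⊆ B̄(0,2)`
  have hT : tsupport (fderiv ℝ ζ) ⊆ closedBall (0 : EuclideanSpace ℝ (Fin 3)) 2 :=
    (tsupport_fderiv_subset ℝ).trans (hζ1.trans spaceCyl_subset_closedBall)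
  have hDζ0 : ∀ x ∉ closedBall (0 : EuclideanSpace ℝ (Fin 3)) 2, fderiv ℝ ζ x = 0 := fun x hx =>
    image_eq_zero_of_notMem_tsupport fun h => hx (hT h)
  have hq0 : ∀ x ∉ tsupport (fderiv ℝ ζ), radDerivQuot ζ x = 0 := fun x hx =>
    radDerivQuot_eq_zero_of_notMem_tsupport_fderiv hζ hζax hx
  have hζle : ∀ x, |ζ x| ≤ 1 := fun x => by rw [abs_of_nonneg (hζ01 x).1]; exact (hζ01 x).2
  have hB2 : ∀ x ∈ K, G x ^ 2 ≤ B ^ 2 := fun x hx => by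
    have h := hGB x hx
    rw [← sq_abs]
    exact pow_le_pow_left₀ (abs_nonneg _) h 2
  have hmemK : ∀ x, fderiv ℝ ζ x ≠ 0 → x ∈ K := fun x hx => hK (subset_tsupport _ (mem_support.2 hx))
  -- (1) the time-derivative term vanishes
  have h1 : (∫ x, ζ x * timeDerivWithin (Ioo a b) (fun _ : ℝ => ζ) t x * G x ^ 2) = 0 := by
    simp only [timeDerivWithin_const_eq_zero, mul_zero, zero_mul, integral_zero]
  -- (2) the drift term
  have h2 : |∫ x, ζ x * G x ^ 2 * fderiv ℝ ζ x (u x)| ≤ B ^ 2 * (Z₁ * D₀) * W := by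
    refine abs_integral_le_of_forall_abs_le (fun x => ?_) (fun x hx => by rw [hDζ0 x hx]; simp)
    by_cases hx : fderiv ℝ ζ x = 0
    · rw [hx]; simp; positivity
    · have hxK := hmemK x hx
      rw [abs_mul, abs_mul, abs_of_nonneg (sq_nonneg (G x))]
      have hd : |fderiv ℝ ζ x (u x)| ≤ Z₁ * D₀ := by
        rw [← Real.norm_eq_abs]
        exact ((fderiv ℝ ζ x).le_opNorm (u x)).trans (mul_le_mul (hZ₁ x) (h0 x hxK) (norm_nonneg _) hZ₁0)
      calc |ζ x| * G x ^ 2 * |fderiv ℝ ζ x (u x)| ≤ 1 * B ^ 2 * (Z₁ * D₀) :=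
            mul_le_mul (mul_le_mul (hζle x) (hB2 x hxK) (sq_nonneg _) zero_le_one) hd (abs_nonneg _)
              (by positivity)
        _ = B ^ 2 * (Z₁ * D₀) := by ring
  -- (3) the `|∇ζ|²` term
  have h3 : |∫ x, G x ^ 2 * (fderiv ℝ ζ x (EuclideanSpace.single 0 1) ^ 2 +
      fderiv ℝ ζ x (EuclideanSpace.single 1 1) ^ 2 + fderiv ℝ ζ x (EuclideanSpace.single 2 1) ^ 2)| ≤
      B ^ 2 * Z₁ ^ 2 * W := by
    refine abs_integral_le_of_forall_abs_le (fun x => ?_) (fun x hx => by rw [hDζ0 x hx]; simp)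
    rw [← norm_fderiv_sq_eq_sum_sq]
    by_cases hx : fderiv ℝ ζ x = 0
    · rw [hx]; simp; positivity
    · have hxK := hmemK x hx
      rw [abs_of_nonneg (by positivity)]
      exact mul_le_mul (hB2 x hxK) (pow_le_pow_left₀ (norm_nonneg _) (hZ₁ x) 2) (sq_nonneg _) (sq_nonneg _)
  -- (4) the radial-derivative term
  have h4 : |∫ x, ζ x * G x ^ 2 * radDerivQuot ζ x| ≤ B ^ 2 * Q₀ * W := by
    refine abs_integral_le_of_forall_abs_le (fun x => ?_) (fun x hx => by rw [hq0 x fun h => hx (hT h)]; simp)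
    by_cases hx : x ∈ tsupport (fderiv ℝ ζ)
    · have hxK := hK hx
      rw [abs_mul, abs_mul, abs_of_nonneg (sq_nonneg (G x))]
      calc |ζ x| * G x ^ 2 * |radDerivQuot ζ x| ≤ 1 * B ^ 2 * Q₀ :=
            mul_le_mul (mul_le_mul (hζle x) (hB2 x hxK) (sq_nonneg _) zero_le_one) (hQ₀ x) (abs_nonneg _)
              (by positivity)
        _ = B ^ 2 * Q₀ := by ring
    · rw [hq0 x hx]; simp; positivity
  -- assemble
  have hWV : B ^ 2 * (2 * (Z₁ * D₀) + 2 * ν * Z₁ ^ 2 + 4 * ν * Q₀) * W ≤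
      B ^ 2 * (2 * (Z₁ * D₀) + 2 * ν * Z₁ ^ 2 + 4 * ν * Q₀) * V :=
    mul_le_mul_of_nonneg_left hV (by positivity)
  rw [h1, mul_zero, zero_add]
  have e2 := (le_abs_self _).trans h2
  have e3 := (le_abs_self _).trans h3
  have e4 := (neg_le_abs _).trans h4
  nlinarith [mul_le_mul_of_nonneg_left e3 (by positivity : (0 : ℝ) ≤ 2 * ν),
    mul_le_mul_of_nonneg_left e4 (by positivity : (0 : ℝ) ≤ 4 * ν)]

end Group

/-! ### `hcut` for the time-independent cut-off -/

/-- **Seregin 2022, §2 Step 3, `A₁ + B₁ + A₂ + B₂ ≤ C(v, η)` on the final slab: the hypothesis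
`hcut` of `cutoff_energy_keyEstimate_unconditional` for a time-independent cut-off.** For one
slice: an axisymmetric `v ∈ C³`, an axisymmetric `ζ ∈ C²` with `0 ≤ ζ ≤ 1`, `tsupport ζ ⊆ 𝒞`,
`‖∇ζ‖ ≤ Z₁`, `|q_ζ| ≤ Q₀`, a set `K ⊇ tsupport ∇ζ` with `‖v‖ ≤ D₀`, `‖D²v‖ ≤ D₂` on `K`, `ν ≥ 0`,
`|B̄(0,2)| ≤ V`: the eight-integral expression of `hcut` (with `ζ(t, ·) = ζ`, `Γ = angVortQuot v`,
`Φ = radVelQuot (curl v)`, `|Γ|, |Φ| ≤ κ‖D²v‖ ≤ κD₂` on `K`) is at most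
`Bcut = 2(2Z₁D₀ + 2νZ₁² + 4νQ₀)(κD₂)²V`, `κ = ‖curlCLM‖`. Registered sub-goal toward
`stub_sereginLogSwirlOrigin`. [cite: Seregin2022LocalAxisym, §2 Step 3 (arXiv:2201.00153 p. 6), A₁+B₁ ≤ C(v,η), A₂+B₂ ≤ C(v,η)] -/
theorem cut_bound : ∀ (u : EuclideanSpace ℝ (Fin 3) → EuclideanSpace ℝ (Fin 3)) (ζ : EuclideanSpace ℝ (Fin 3) → ℝ) (K : Set (EuclideanSpace ℝ (Fin 3))) (a b ν t D₀ D₂ Z₁ Q₀ V : ℝ), ContDiff ℝ 3 u → IsAxisymmetric u → ContDiff ℝ 2 ζ → IsAxisymmetricScalar ζ → (∀ x, 0 ≤ ζ x ∧ ζ x ≤ 1) → tsupport ζ ⊆ SereginSverak2009.spaceCyl 0 1 → tsupport (fderiv ℝ ζ) ⊆ K → 0 ≤ ν → 0 ≤ D₀ → 0 ≤ D₂ → 0 ≤ Z₁ → 0 ≤ Q₀ → volume.real (closedBall (0 : EuclideanSpace ℝ (Fin 3)) 2) ≤ V → (∀ x, ‖fderiv ℝ ζ x‖ ≤ Z₁)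 → (∀ x, |radDerivQuot ζ x| ≤ Q₀) → (∀ x ∈ K, ‖u x‖ ≤ D₀) → (∀ x ∈ K, ‖iteratedFDeriv ℝ 2 u x‖ ≤ D₂) → (2 * (∫ x, ζ x * timeDerivWithin (Ioo a b) (fun _ : ℝ => ζ) t x * angVortQuot u x ^ 2) + 2 * (∫ x, ζ x * angVortQuot u x ^ 2 * fderiv ℝ ζ x (u x)) + 2 * ν * (∫ x, angVortQuot u x ^ 2 * (fderiv ℝ ζ x (EuclideanSpace.single 0 1) ^ 2 + fderiv ℝ ζ x (EuclideanSpace.single 1 1) ^ 2 + fderiv ℝ ζ x (EuclideanSpace.single 2 1) ^ 2)) - 4 * ν * (∫ x, ζ x * angVortQuot u x ^ 2 * radDerivQuot ζ x)) + (2 * (∫ x, ζ x * timeDerivWithin (Ioo a b) (fun _ : ℝ => ζ) t x * radVelQuot (curl u) x ^ 2) + 2 * (∫ x, ζ x * radVelQuot (curl u) x ^ 2 * fderiv ℝ ζ x (u x)) + 2 * ν * (∫ x, radVelQuot (curl u) x ^ 2 * (fderiv ℝ ζ x (EuclideanSpace.single 0 1) ^ 2 + fderiv ℝ ζ x (EuclideanSpace.single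 1 1) ^ 2 + fderiv ℝ ζ x (EuclideanSpace.single 2 1) ^ 2)) - 4 * ν * (∫ x, ζ x * radVelQuot (curl u) x ^ 2 * radDerivQuot ζ x)) ≤ 2 * ((2 * (Z₁ * D₀) + 2 * ν * Z₁ ^ 2 + 4 * ν * Q₀) * (‖curlCLM‖ * D₂) ^ 2 * V) := by
  intro u ζ K a b ν t D₀ D₂ Z₁ Q₀ V hu hax hζ hζax hζ01 hζ1 hK hν hD₀ hD₂ hZ₁0 hQ₀0 hV hZ₁ hQ₀ h0 h2
  have hu2 : ContDiff ℝ 2 u := hu.of_le (by norm_num)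
  have hω : ∀ x ∈ K, ‖fderiv ℝ (curl u) x‖ ≤ ‖curlCLM‖ * D₂ := fun x hx =>
    (norm_fderiv_curl_le hu2 x).trans (mul_le_mul_of_nonneg_left (h2 x hx) (norm_nonneg curlCLM))
  have hΓ : ∀ x ∈ K, |angVortQuot u x| ≤ ‖curlCLM‖ * D₂ := fun x hx =>
    (hax.abs_angVortQuot_le_norm_fderiv_curl hu x).trans (hω x hx)
  have hΦ : ∀ x ∈ K, |radVelQuot (curl u) x| ≤ ‖curlCLM‖ * D₂ := fun x hx =>
    (hax.abs_radVelQuot_curl_le_norm_fderiv_curl hu x).trans (hω x hx)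
  have gΓ := cut_group_le (a := a) (b := b) (t := t) hζ hζax hζ01 hζ1 hK hν hD₀ hZ₁0 hQ₀0 hV hZ₁ hQ₀ h0 hΓ
  have gΦ := cut_group_le (a := a) (b := b) (t := t) hζ hζax hζ01 hζ1 hK hν hD₀ hZ₁0 hQ₀0 hV hZ₁ hQ₀ h0 hΦ
  linarith

end Summit.NavierStokesRegularity.NavierStokesRegularity.Theorems.AxisymmetricKatoGlobal.EulerScaling

end
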